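import Mathlib.NumberTheory.Padics.RingHoms
import Mathlib.NumberTheory.Padics.ProperSpace
import Mathlib.Topology.MetricSpace.Ultra.Basic
import Mathlib.LinearAlgebra.Span.Basic
import Mathlib.RingTheory.Finiteness.Defs
import HarnessLib

/-!
# Topological Nakayama over `ℤ_p` without completeness: a `p`-adically separated `ℤ_p`-module `M`
# with `M = ⟨s⟩ + pM` for a finite `s` is generated by `s`

Topic `NumberTheory/EllipticCurves` (namespace = path; filed next to its consumers
`Kato2004/IntegralH1FiniteProofs.lean`, `Kato2004/IwasawaH2DataOfInjectivityProofs.lean` and the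
`IwasawaAlgebra*Proofs` files). Cell `bsd-cn100`, prover seat `bsd-cn100-transfer-2` (g8).
`Proofs`-style file: theorems only (no definition, no named fact, no `sorry`, no instance).

## Statement and proof

Let `M` be a `ℤ_p`-module which is **`p`-adically separated** — an element divisible by every
power of `p` is `0` — and let `s ⊆ M` be a finite set with `M = ⟨s⟩ + p·M`.  Then `M = ⟨s⟩`
(`span_eq_top_of_separated_of_forall_exists_sub_smul_mem_span`); in particular `M` is a finitely
generated `ℤ_p`-module (`module_finite_of_separated_of_forall_exists_sub_smul_mem_span`).  The usual
textbook form assumes `M` `p`-adically COMPLETE (Nakayama for complete local rings, e.g.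
[Washington 1997, Lemma 13.16]; [NSW 2008, (5.2.18)]); separatedness suffices because `ℤ_p` is
compact: iterating `M = ⟨s⟩ + pM` gives `M = ⟨s⟩ + p^k M` for every `k`, so for `x ∈ M` the sets
`D_k = {c ∈ ℤ_p^s : x − Σ c_i s_i ∈ p^k M}` are non-empty; they decrease with `k` and are closed
(even clopen: membership depends only on `c mod p^k`), so by compactness of `ℤ_p^s` they have a
common point `c`, and then `x − Σ c_i s_i ∈ ⋂_k p^k M = 0`.  The consumer shape
`module_finite_of_separated_of_addMonoidHom_finite` takes the hypothesis "`M = ⟨s⟩ + pM` for a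
finite `s`" in the form in which it arises: an additive map `f : M → F` to a finite group whose
kernel consists of `p`-multiples (so that `M/pM ↪ F`).

## References

* L. C. Washington, *Introduction to Cyclotomic Fields*, 2nd ed., GTM 83 (1997), Lemma 13.16
  (Nakayama's lemma for compact `Λ`-modules). [Washington1997]
* J. Neukirch, A. Schmidt, K. Wingberg, *Cohomology of Number Fields*, 2nd ed. (2008), (5.2.18).
  [NeukirchSchmidtWingberg2008]
* Mathlib: `PadicInt.compactSpace`, `PadicInt.norm_le_pow_iff_mem_span_pow`,
  `IsUltrametricDist.isOpen_closedBall`,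
  `IsCompact.nonempty_iInter_of_sequence_nonempty_isCompact_isClosed`.
-/

noncomputable section

open scoped Pointwise

namespace Literature.NumberTheory.EllipticCurves

variable {p : ℕ} [Fact p.Prime] {M : Type*} [AddCommGroup M] [Module ℤ_[p] M]

/-- Two tuples of `p`-adic integers that are coordinatewise congruent modulo `p^k` give congruent
combinations: `Σ c_i s_i − Σ c'_i s_i ∈ p^k · M`. [folklore] -/
private theorem exists_pow_smul_eq_sum_sub_sum {ι : Type*} (t : Finset ι) (v : ι → M) (k : ℕ)
    {c c' : ι → ℤ_[p]} (h : ∀ i ∈ t, ‖c i - c' i‖ ≤ (p : ℝ) ^ (-(k : ℤ))) :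
    ∃ y : M, ((p : ℤ_[p]) ^ k) • y = ∑ i ∈ t, c i • v i - ∑ i ∈ t, c' i • v i := by
  classical
  -- coordinatewise: `c i - c' i = p^k * d i`
  have hd : ∀ i ∈ t, ∃ d : ℤ_[p], c i - c' i = (p : ℤ_[p]) ^ k * d := fun i hi => by
    have hmem : c i - c' i ∈ Ideal.span {((p : ℤ_[p]) ^ k)} :=
      (PadicInt.norm_le_pow_iff_mem_span_pow _ _).mp (h i hi)
    obtain ⟨d, hd⟩ := Ideal.mem_span_singleton'.mp hmem
    exact ⟨d, by rw [← hd, mul_comm]⟩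
  choose! d hd using hd
  refine ⟨∑ i ∈ t, d i • v i, ?_⟩
  rw [← Finset.sum_sub_distrib, Finset.smul_sum]
  refine Finset.sum_congr rfl fun i hi => ?_
  rw [← sub_smul, hd i hi, mul_smul]

/-- **`M = ⟨s⟩ + pM` iterates to `M = ⟨s⟩ + p^k M`.** [folklore] -/
private theorem exists_sub_pow_smul_mem_span (s : Finset M)
    (hgen : ∀ x : M, ∃ y : M, x - (p : ℤ_[p]) • y ∈ Submodule.span ℤ_[p] (s : Set M))
    (k : ℕ) (x : M) :
    ∃ y : M, x - ((p : ℤ_[p]) ^ k) • y ∈ Submodule.span ℤ_[p] (s : Set M) := by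
  induction k generalizing x with
  | zero => exact ⟨x, by rw [pow_zero, one_smul, sub_self]; exact Submodule.zero_mem _⟩
  | succ k ih =>
    obtain ⟨y, hy⟩ := hgen x
    obtain ⟨z, hz⟩ := ih y
    refine ⟨z, ?_⟩
    have : x - ((p : ℤ_[p]) ^ (k + 1)) • z =
        (x - (p : ℤ_[p]) • y) + (p : ℤ_[p]) • (y - ((p : ℤ_[p]) ^ k) • z) := by
      rw [smul_sub, smul_smul, ← pow_succ']
      abel
    rw [this]
    exact Submodule.add_mem _ hy (Submodule.smul_mem _ _ hz)

/-- **Topological Nakayama over `ℤ_p`, separated form.**  If `M` is `p`-adically separated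
(`x ∈ ⋂_k p^k M ⟹ x = 0`) and `M = ⟨s⟩ + pM` for a finite set `s`, then `⟨s⟩ = M`.  Proof by
compactness of `ℤ_p^s` (module docstring). [cite: Washington1997, Lemma 13.16] -/
theorem span_eq_top_of_separated_of_forall_exists_sub_smul_mem_span
    (hsep : ∀ x : M, (∀ k : ℕ, ∃ y : M, ((p : ℤ_[p]) ^ k) • y = x) → x = 0) (s : Finset M)
    (hgen : ∀ x : M, ∃ y : M, x - (p : ℤ_[p]) • y ∈ Submodule.span ℤ_[p] (s : Set M)) :
    Submodule.span ℤ_[p] (s : Set M) = ⊤ := by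
  classical
  refine Submodule.eq_top_iff'.mpr fun x => ?_
  -- the index type: the elements of `s`
  let ι : Type _ := ↥s
  let v : ι → M := fun i => (i : M)
  -- `D k = {c : ι → ℤ_p | x - Σ c_i s_i ∈ p^k M}`
  let D : ℕ → Set (ι → ℤ_[p]) := fun k =>
    {c | ∃ y : M, ((p : ℤ_[p]) ^ k) • y = x - ∑ i, c i • v i}
  -- non-empty: `M = ⟨s⟩ + p^k M` and an element of `⟨s⟩` is a combination of `s`
  have hne : ∀ k, (D k).Nonempty := fun k => by
    obtain ⟨y, hy⟩ := exists_sub_pow_smul_mem_span s hgen k x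
    obtain ⟨f, -, hf⟩ := Submodule.mem_span_finset.mp hy
    refine ⟨fun i => f i, y, ?_⟩
    have hsum : ∑ i : ι, f i • v i = ∑ a ∈ s, f a • a := Finset.sum_coe_sort s (fun a => f a • a)
    rw [hsum, hf, sub_sub_cancel]
  -- decreasing
  have hmono : ∀ k, D (k + 1) ⊆ D k := fun k c ⟨y, hy⟩ =>
    ⟨(p : ℤ_[p]) • y, by rw [smul_smul, ← pow_succ, hy]⟩
  -- closed: membership depends only on `c mod p^k`
  have hclosed : ∀ k, IsClosed (D k) := fun k => by
    rw [← isOpen_compl_iff, isOpen_iff_forall_mem_open]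
    intro c hc
    -- the box `{c' | ∀ i, ‖c' i - c i‖ ≤ p^{-k}}` is open and misses `D k`
    refine ⟨{c' | ∀ i, ‖c' i - c i‖ ≤ (p : ℝ) ^ (-(k : ℤ))}, fun c' hc' hD => hc ?_, ?_,
      fun i => by simp⟩
    · obtain ⟨y, hy⟩ := hD
      obtain ⟨z, hz⟩ := exists_pow_smul_eq_sum_sub_sum (Finset.univ : Finset ι) v k
        (c := c') (c' := c) (fun i _ => hc' i)
      exact ⟨y + z, by rw [smul_add, hy, hz]; abel⟩
    · have : {c' : ι → ℤ_[p] | ∀ i, ‖c' i - c i‖ ≤ (p : ℝ) ^ (-(k : ℤ))} =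
          ⋂ i, (fun c' : ι → ℤ_[p] => c' i) ⁻¹' Metric.closedBall (c i) ((p : ℝ) ^ (-(k : ℤ))) := by
        ext c'
        simp only [Set.mem_setOf_eq, Set.mem_iInter, Set.mem_preimage, Metric.mem_closedBall,
          dist_eq_norm]
      rw [this]
      exact isOpen_iInter_of_finite fun i =>
        (IsUltrametricDist.isOpen_closedBall (c i) (zpow_ne_zero _ (by exact_mod_cast
          (Fact.out : p.Prime).ne_zero))).preimage (continuous_apply i)
  -- compactness of `ℤ_p^s`
  obtain ⟨c, hc⟩ := IsCompact.nonempty_iInter_of_sequence_nonempty_isCompact_isClosed D hmono hne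
    (isCompact_univ.of_isClosed_subset (hclosed 0) (Set.subset_univ _)) hclosed
  -- the common point: `x - Σ c_i s_i ∈ ⋂_k p^k M = 0`
  have hx : x - ∑ i, c i • v i = 0 :=
    hsep _ fun k => by
      obtain ⟨y, hy⟩ := Set.mem_iInter.mp hc k
      exact ⟨y, hy⟩
  rw [sub_eq_zero] at hx
  rw [hx]
  exact Submodule.sum_mem _ fun i _ => Submodule.smul_mem _ _ (Submodule.subset_span i.2)

/-- **Finite generation from separatedness and `M = ⟨s⟩ + pM`.** [cite: Washington1997, Lemma 13.16] -/
theorem module_finite_of_separated_of_forall_exists_sub_smul_mem_span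
    (hsep : ∀ x : M, (∀ k : ℕ, ∃ y : M, ((p : ℤ_[p]) ^ k) • y = x) → x = 0) (s : Finset M)
    (hgen : ∀ x : M, ∃ y : M, x - (p : ℤ_[p]) • y ∈ Submodule.span ℤ_[p] (s : Set M)) :
    Module.Finite ℤ_[p] M :=
  ⟨⟨s, span_eq_top_of_separated_of_forall_exists_sub_smul_mem_span hsep s hgen⟩⟩

/-- **Consumer shape: `M/pM` finite via a homomorphism.**  If `M` is `p`-adically separated and
there is an additive map `f : M → F` to a finite group whose kernel consists of `p`-multiples
(`f x = 0 ⟹ x ∈ pM`, so `M/pM ↪ F` is finite), then `M` is a finitely generated `ℤ_p`-module: a set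
`s` of representatives of the values of `f` satisfies `M = ⟨s⟩ + pM`.
[cite: Washington1997, Lemma 13.16] -/
theorem module_finite_of_separated_of_addMonoidHom_finite {F : Type*} [AddCommGroup F] [Finite F]
    (hsep : ∀ x : M, (∀ k : ℕ, ∃ y : M, ((p : ℤ_[p]) ^ k) • y = x) → x = 0)
    (f : M →+ F) (hf : ∀ x : M, f x = 0 → ∃ y : M, (p : ℤ_[p]) • y = x) :
    Module.Finite ℤ_[p] M := by
  classical
  haveI : Fintype F := Fintype.ofFinite F
  -- representatives of the fibres of `f`
  let r : F → M := fun a => if h : ∃ x : M, f x = a then h.choose else 0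
  have hr : ∀ x : M, f (r (f x)) = f x := fun x => by
    have h : ∃ x' : M, f x' = f x := ⟨x, rfl⟩
    simp only [r, dif_pos h]
    exact h.choose_spec
  refine module_finite_of_separated_of_forall_exists_sub_smul_mem_span hsep
    (Finset.univ.image r) fun x => ?_
  have h0 : f (x - r (f x)) = 0 := by rw [map_sub, hr, sub_self]
  obtain ⟨y, hy⟩ := hf _ h0
  refine ⟨y, ?_⟩
  rw [hy, sub_sub_cancel]
  exact Submodule.subset_span (Finset.mem_coe.mpr (Finset.mem_image_of_mem r (Finset.mem_univ _)))

end Literature.NumberTheory.EllipticCurves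

end
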